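import Mathlib.Tactic
import HarnessLib

/-!
# Kozma–Nitzan's Question 8 at three relays — the centring half (T2) = (MPHI) for a PENDANT-TYPE OBSERVER, scalar skeleton

Support file (`--supports stmt-CriticalPhenomena-4575`, closed crux; independent mathematics on Kozma–Nitzan's Question 8,
arXiv:2401.12397 §5.5 p. 36), prover `prim-ineq-gen-7` (gen 16).  No definitions, no named facts, no sorries; standard axioms.
Memo `run/shared/lean/prim/prim-ineq-gen-7/FINDING-MPHI-g16.md` §1–§2.  Companions: `…KnQuestion8XDReduction.lean` (gen 15),
`…KnQuestion8IslandSlice.lean` (prim-ineq-gen-6, the analogous v-island slice), `…KnQuestion8FrameDominations.lean` (gen 12).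

Setting (memo FINDING-TSTAR-g12 §0, FINDING-XD-g15 §8b/§11).  Owner `x`, observer `o`, marker `v`, frame `Y`, `S = {x,o}`,
`ν' = μ(· | S ↮ Y)`; atoms of `(C_x, C_o)`: `O = {o ∈ C_x}`, `E = {o ∉ C_x, v ∈ C_o}`, `PV = {o ∉ C_x, v ∉ C_o, v ∈ C_x}`, `PM` = rest,
masses `a, e, π_V, π_M` (sum `1`), `π = π_V + π_M`, `o2 = a + e`, `κ π_M = a π_M − e π_V` (≥ 0, PAC).  For a test function `g` with
`g_A := E'[g ; A]` the (T*) functional is `π g_O − o2 g_PV − κ g_PM`; the CENTRING HALF (T2) of the Q8@3 atom is (T*) for the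
test functions `g = 1{C_Y ∈ 𝒟}`, `𝒟` a down-set of frame clusters ("(MPHI)", memo XD-g15 §8b, §11; census 0 / 54 409).

* `PocketCert.tstar_cov_form` — the COVARIANCE FORM of (T*) (any `g`, any frame), denominator-free (× `π_M`):
    `π_M (π g_O − o2 g_PV) − (a π_M − e π_V) g_PM = π_M (g_O − a ḡ) + π_M o2 (g_E − e ḡ) + e π (g_PM − π_M ḡ)`,  `ḡ = g_O + g_E + g_PV + g_PM`,
  i.e. `(T*)[g] = Cov'(g, 1_O) + o2·Cov'(g, 1_E) + (eπ/π_M)·Cov'(g, 1_PM)`; for `g = 1_𝒟(C_Y)` the first covariance is `≥ 0` and the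
  third `≤ 0` by van den Berg–Häggström–Kahn's Thm 2.1 (tree `BHK2006_twoSetConditionalAssociation`), the middle one is unsigned.
* `PocketCert.mphi_pendant_eq`, `…_coeffs`, `…_pac`, `…_regroup`, `…_nonneg` — **THEOREM (pendant-type observer).**
  Suppose `N(o) ⊆ {x, v}` with edge weights `r = p_{ox}`, `s = p_{ov}`, `R := (1−r)(1−s)`; `H := G − o`.  Integrating o's two edges,
  `ν'` is the law `λ(η) ∝ μ_H(η)·(1 − s·1[v ∈ C_Y])·1[x ↮ Y]` on configurations `η` of `H` (the factor `1 − s·1[v ∈ C_Y]` is the frame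
  killing the edge `ov` when `v ∈ C_Y`; it is realised as `{o' ↮ Y}` for a ghost vertex `o'` pendant at `v` with weight `s`, so `λ` is the
  `H`-marginal of `μ_{H+o'}(· | Y ↮ {x, o'})`), followed by the two independent coins of `o`.  Types of `η`: `V = {v ∈ C_x}`, `U = {v ∈ C_Y}`,
  `Q` = neither, with `λ`-masses `p, q, u` (`p + q + u = 1`); given the type the atom is: `V`: `OV` w.p. `1−R`, `PV` w.p. `R`;
  `Q`: `O` w.p. `r` (`OV` if both coins, `OM` if only `ox`), `E` w.p. `(1−r)s`, `PM` w.p. `R`; `U` (coin `ov` forced closed): `OM` w.p. `r`,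
  `PM` w.p. `1−r`.  Hence `a = (1−R)p + r(q+u)`, `e = (1−r)s q`, `π_V = R p`, `π_M = R q + (1−r) u`, and for a down-set `𝒟` with type masses
  `L_V = λ(V ∩ {C_Y ∈ 𝒟})`, `L_Q`, `L_U`: `ν'(O;𝒟) = (1−R)L_V + r L_Q + r L_U`, `ν'(PV;𝒟) = R L_V`, `ν'(PM;𝒟) = R L_Q + (1−r) L_U`.
  `mphi_pendant_eq`: `π_M·MPHI(𝒟) = B_V L_V + B_Q L_Q + B_U L_U` with `B_V = π_M(π(1−R) − o2 R)`, `B_Q = π_M π r − (aπ_M − eπ_V)R`,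
  `B_U = π_M π r − (aπ_M − eπ_V)(1−r)`, and `p B_V + q B_Q + u B_U = 0`;  `mphi_pendant_coeffs`: `B_V − B_Q = π(1−r)² s u`,
  `B_U − B_Q = −(aπ_M − eπ_V)(1−r)s`;  `mphi_pendant_pac`: `aπ_M − eπ_V = rRq + r(1−r)u + (1−r)² s p u` (PAC, explicit);
  `mphi_pendant_regroup` (abstract bookkeeping): with `Λ = L_V + L_Q + L_U`, `Δ_V := L_V − pΛ = Cov_λ(1_V, 1_𝒟)`, `Δ_U := L_U − uΛ`,
      `π_M·MPHI(𝒟) = (B_V − B_Q)·Δ_V + (B_U − B_Q)·Δ_U`   (given the centring and `p + q + u = 1`);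
  `mphi_pendant_nonneg`: `Δ_V ≥ 0` (BHK Thm 2.1 in `H + o'` given `Y ↮ {x,o'}`: `1[v ∈ C_x]` is increasing in `C_{{x,o'}}`, `1_𝒟(C_Y)`
  decreasing in `C_Y`) and `Δ_U ≤ 0` (BHK Thm 1.3: `C_Y` is positively associated given `Y ↮ {x,o'}`) give `MPHI(𝒟) ≥ 0`:
  **(T2), hence the centring half of the Q8@3 atom, holds for every finite weighted graph whose observer has `N(o) ⊆ {x, v}`, every frame `Y`.**
  When `v ∉ C_Y` a.s. (`u = 0`) the functional vanishes identically: the (T*) constant `β` is sharp exactly on this family.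
* `PocketCert.mphi_vpendant_eq`, `…_nonneg` — the dual easy case `N(v) ⊆ {x, o}` (pendant-type MARKER): (MPHI) is ONE BHK covariance.
* `PocketCert.mphi_commutator_form` — `T_𝒟 = M_PM·[P,O]_𝒟 − M_E·[PM,PV]_𝒟`, i.e. (MPHI) ⟺ `aπ(d_O − d_P) ≥ eπ_V(d_PV − d_PM)`.
* `PocketCert.mphi_oneedge_bernstein` — the one-edge Bernstein decomposition `T(X(t)) = (1−t)³T₀ + 3t(1−t)²b₁ + 3t²(1−t)b₂ + t³T₁` with the polarised `b₁, b₂`.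
* `PocketCert.mphi_oneedge_Opart_nonneg` — the O-part `PM₁[P₀,O₀] + PM₀([P₁,O₀]+[P₀,O₁])` of `3b₁` is `≥ 0` from six vdBHK mass inequalities (o- or x-edges).
* `PocketCert.mphi_oneedge_step_anatomy` — `PM₀·(3b₁) = PM₁·T₀ + R̂₂`: given (MPHI) for `G ∖ f` the step is the two-graph inequality `R̂₂ ≥ 0`.
* `PocketCert.mphi_xo_edge_eq`, `…_nonneg` — the edge `xo` is irrelevant: `T_G(t) = (1−t)³ T_{G∖xo} + t(1−t)²·PM·(BHK term)`, so (MPHI) for `G ∖ xo` implies (MPHI) for `G`.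
[cite: KozmaNitzan2024, Question 8 (§5.5 p. 36)] [cite: VandenbergHaggstromKahn2005, Thm. 2.1 (p. 9), Thm. 1.3 (p. 6)]
-/

namespace Summit.CriticalPhenomena.PercolationContinuityZ3.Theorems

namespace PocketCert

/-- **Covariance form of (T*)** (ring identity modulo `a + e + π_V + π_M = 1`; dictionary in the module docstring):
`π_M (π g_O − o2 g_PV) − (a π_M − e π_V) g_PM = π_M (g_O − a ḡ) + π_M o2 (g_E − e ḡ) + e π (g_PM − π_M ḡ)`.
[cite: KozmaNitzan2024, Question 8 (§5.5 p. 36)] -/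
theorem tstar_cov_form (a e pV pM gO gE gPV gPM : ℝ) (hsum : a + e + pV + pM = 1) :
    pM * ((pV + pM) * gO - (a + e) * gPV) - (a * pM - e * pV) * gPM =
      pM * (gO - a * (gO + gE + gPV + gPM)) + pM * (a + e) * (gE - e * (gO + gE + gPV + gPM)) +
        e * (pV + pM) * (gPM - pM * (gO + gE + gPV + gPM)) := by
  linear_combination (pM * (gO + e * (gO + gE + gPV + gPM))) * hsum

/-- **Pendant-type observer, slice identity** (pure ring identities; dictionary in the module docstring): with
`R = (1−r)(1−s)`, `a = (1−R)p + r(q+u)`, `e = (1−r)sq`, `π_V = Rp`, `π_M = Rq + (1−r)u` and the type-by-down-set masses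
`LV, LQ, LU`:  `π_M·MPHI(𝒟) = B_V LV + B_Q LQ + B_U LU` and `p B_V + q B_Q + u B_U = 0`.
[cite: KozmaNitzan2024, Question 8 (§5.5 p. 36)] -/
theorem mphi_pendant_eq (r s p q u LV LQ LU : ℝ) :
    ((1 - r) * (1 - s) * q + (1 - r) * u) *
          (((1 - r) * (1 - s) * p + ((1 - r) * (1 - s) * q + (1 - r) * u)) *
              ((1 - (1 - r) * (1 - s)) * LV + r * LQ + r * LU) -
            ((1 - (1 - r) * (1 - s)) * p + r * (q + u) + (1 - r) * s * q) * ((1 - r) * (1 - s) * LV)) -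
        (((1 - (1 - r) * (1 - s)) * p + r * (q + u)) * ((1 - r) * (1 - s) * q + (1 - r) * u) -
            (1 - r) * s * q * ((1 - r) * (1 - s) * p)) *
          ((1 - r) * (1 - s) * LQ + (1 - r) * LU) =
      (((1 - r) * (1 - s) * q + (1 - r) * u) * (((1 - r) * (1 - s) * p + ((1 - r) * (1 - s) * q + (1 - r) * u)) * (1 - (1 - r) * (1 - s)) - ((1 - (1 - r) * (1 - s)) * p + r * (q + u) + (1 - r) * s * q) * ((1 - r) * (1 - s)))) * LV + (((1 - r) * (1 - s) * q + (1 - r) * u) * ((1 - r) * (1 - s) * p + ((1 - r) * (1 - s) * q + (1 - r) * u)) * r - (((1 - (1 - r) * (1 - s)) * p + r * (q + u)) * ((1 - r) * (1 - s) * q + (1 - r) * u) - (1 - r) * s * q * ((1 - r) * (1 - s) * p)) * ((1 - r) * (1 - s))) * LQ + (((1 - r) * (1 - s) * q + (1 - r) * u) * ((1 - r) * (1 - s) * p + ((1 - r) * (1 - s) * q + (1 - r) * u)) * r - (((1 - (1 - r) * (1 - s)) * p + r * (q + u)) * ((1 - r) * (1 - s) * q + (1 - r) * u) - (1 - r) *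 s * q * ((1 - r) * (1 - s) * p)) * (1 - r)) * LU ∧
      p * (((1 - r) * (1 - s) * q + (1 - r) * u) * (((1 - r) * (1 - s) * p + ((1 - r) * (1 - s) * q + (1 - r) * u)) * (1 - (1 - r) * (1 - s)) - ((1 - (1 - r) * (1 - s)) * p + r * (q + u) + (1 - r) * s * q) * ((1 - r) * (1 - s)))) + q * (((1 - r) * (1 - s) * q + (1 - r) * u) * ((1 - r) * (1 - s) * p + ((1 - r) * (1 - s) * q + (1 - r) * u)) * r - (((1 - (1 - r) * (1 - s)) * p + r * (q + u)) * ((1 - r) * (1 - s) * q + (1 - r) * u) - (1 - r) * s * q * ((1 - r) * (1 - s) * p)) * ((1 - r) * (1 - s))) + u * (((1 - r) * (1 - s) * q + (1 - r) * u) * ((1 - r) * (1 - s) * p + ((1 - r) * (1 - s) * q + (1 - r) * u)) * r - (((1 - (1 - r) * (1 - s)) * p + r * (q + u)) * ((1 - r) * (1 - s) * q + (1 - r) * u) - (1 - r) * s * q * ((1 - r) * (1 - s) * p)) * (1 - r)) = 0 := by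
  constructor <;> ring

/-- **The two coefficient identities** (pure ring identities): `B_V − B_Q = π (1−r)² s u` and
`B_U − B_Q = −(a π_M − e π_V)(1−r) s`.
[cite: KozmaNitzan2024, Question 8 (§5.5 p. 36)] -/
theorem mphi_pendant_coeffs (r s p q u : ℝ) :
    (((1 - r) * (1 - s) * q + (1 - r) * u) * (((1 - r) * (1 - s) * p + ((1 - r) * (1 - s) * q + (1 - r) * u)) * (1 - (1 - r) * (1 - s)) - ((1 - (1 - r) * (1 - s)) * p + r * (q + u) + (1 - r) * s * q) * ((1 - r) * (1 - s)))) - (((1 - r) * (1 - s) * q + (1 - r) * u) * ((1 - r) * (1 - s) * p + ((1 - r) * (1 - s) * q + (1 - r) * u)) * r - (((1 - (1 - r) * (1 - s)) * p + r * (q + u)) * ((1 - r) * (1 - s) * q + (1 - r) * u) - (1 - r) * s * q * ((1 - r) * (1 - s) * p)) * ((1 - r) * (1 - s))) = ((1 - r) * (1 - s) * p + ((1 - r) * (1 - s) * q + (1 - r) * u)) * (1 - r) ^ 2 * s * u ∧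
      (((1 - r) * (1 - s) * q + (1 - r) * u) * ((1 - r) * (1 - s) * p + ((1 - r) * (1 - s) * q + (1 - r) * u)) * r - (((1 - (1 - r) * (1 - s)) * p + r * (q + u)) * ((1 - r) * (1 - s) * q + (1 - r) * u) - (1 - r) * s * q * ((1 - r) * (1 - s) * p)) * (1 - r)) - (((1 - r) * (1 - s) * q + (1 - r) * u) * ((1 - r) * (1 - s) * p + ((1 - r) * (1 - s) * q + (1 - r) * u)) * r - (((1 - (1 - r) * (1 - s)) * p + r * (q + u)) * ((1 - r) * (1 - s) * q + (1 - r) * u) - (1 - r) * s * q * ((1 - r) * (1 - s) * p)) * ((1 - r) * (1 - s))) = -((((1 - (1 - r) * (1 - s)) * p + r * (q + u)) * ((1 - r) * (1 - s) * q + (1 - r) * u) - (1 - r) * s * q * ((1 - r) * (1 - s) * p)) * (1 - r) * s) := by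
  constructor <;> ring

/-- **PAC, explicit on the pendant family**: under `p + q + u = 1`,
`a π_M − e π_V = r R q + r (1−r) u + (1−r)² s p u` (so it is `≥ 0` for `r, s ∈ [0,1]`, `p, q, u ≥ 0`).
[cite: KozmaNitzan2024, Question 8 (§5.5 p. 36)] -/
theorem mphi_pendant_pac (r s p q u : ℝ) (hsum : p + q + u = 1) :
    (((1 - (1 - r) * (1 - s)) * p + r * (q + u)) * ((1 - r) * (1 - s) * q + (1 - r) * u) - (1 - r) * s * q * ((1 - r) * (1 - s) * p)) = r * ((1 - r) * (1 - s)) * q + r * (1 - r) * u + (1 - r) ^ 2 * s * p * u := by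
  linear_combination (r * ((1 - r) * (1 - s) * q + (1 - r) * u)) * hsum

/-- **Abstract regrouping** (pure ring identity): for any reals, `B_V LV + B_Q LQ + B_U LU =
(B_V − B_Q)(LV − pΛ) + (B_U − B_Q)(LU − uΛ) + Λ·(p B_V + q B_Q + u B_U) + B_Q·Λ·(1 − (p + q + u))`, `Λ = LV + LQ + LU`.
[cite: KozmaNitzan2024, Question 8 (§5.5 p. 36)] -/
theorem mphi_pendant_regroup (BV BQ BU p q u LV LQ LU : ℝ) :
    BV * LV + BQ * LQ + BU * LU =
      (BV - BQ) * (LV - p * (LV + LQ + LU)) + (BU - BQ) * (LU - u * (LV + LQ + LU)) +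
        (LV + LQ + LU) * (p * BV + q * BQ + u * BU) + BQ * (LV + LQ + LU) * (1 - (p + q + u)) := by
  ring

/-- **THEOREM (pendant-type observer): (MPHI) = (T2) holds when `N(o) ⊆ {x, v}`.**  For coins `r, s ∈ [0,1]`, type masses
`p, q, u ≥ 0` with `p + q + u = 1`, type-by-down-set masses `LV, LQ, LU`, and the two BHK signs
`Δ_V = LV − p(LV+LQ+LU) ≥ 0` (Thm 2.1) and `Δ_U = LU − u(LV+LQ+LU) ≤ 0` (Thm 1.3), the denominator-free (MPHI) functional
`π_M (π ν'(O;𝒟) − o2 ν'(PV;𝒟)) − (a π_M − e π_V) ν'(PM;𝒟)` is nonnegative.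
[cite: KozmaNitzan2024, Question 8 (§5.5 p. 36)] [cite: VandenbergHaggstromKahn2005, Thm. 2.1 (p. 9), Thm. 1.3 (p. 6)] -/
theorem mphi_pendant_nonneg (r s p q u LV LQ LU : ℝ) (hr0 : 0 ≤ r) (hr1 : r ≤ 1) (hs0 : 0 ≤ s) (hs1 : s ≤ 1)
    (hp : 0 ≤ p) (hq : 0 ≤ q) (hu : 0 ≤ u) (hsum : p + q + u = 1)
    (hV : 0 ≤ LV - p * (LV + LQ + LU)) (hU : LU - u * (LV + LQ + LU) ≤ 0) :
    0 ≤ ((1 - r) * (1 - s) * q + (1 - r) * u) *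
          (((1 - r) * (1 - s) * p + ((1 - r) * (1 - s) * q + (1 - r) * u)) *
              ((1 - (1 - r) * (1 - s)) * LV + r * LQ + r * LU) -
            ((1 - (1 - r) * (1 - s)) * p + r * (q + u) + (1 - r) * s * q) * ((1 - r) * (1 - s) * LV)) -
        (((1 - (1 - r) * (1 - s)) * p + r * (q + u)) * ((1 - r) * (1 - s) * q + (1 - r) * u) -
            (1 - r) * s * q * ((1 - r) * (1 - s) * p)) *
          ((1 - r) * (1 - s) * LQ + (1 - r) * LU) := by
  obtain ⟨hM, hcent⟩ := mphi_pendant_eq r s p q u LV LQ LU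
  obtain ⟨hVQ, hUQ⟩ := mphi_pendant_coeffs r s p q u
  have h1r : 0 ≤ 1 - r := by linarith
  have h1s : 0 ≤ 1 - s := by linarith
  have hPI : 0 ≤ ((1 - r) * (1 - s) * p + ((1 - r) * (1 - s) * q + (1 - r) * u)) :=
    add_nonneg (mul_nonneg (mul_nonneg h1r h1s) hp) (add_nonneg (mul_nonneg (mul_nonneg h1r h1s) hq) (mul_nonneg h1r hu))
  have hPAC : 0 ≤ (((1 - (1 - r) * (1 - s)) * p + r * (q + u)) * ((1 - r) * (1 - s) * q + (1 - r) * u) - (1 - r) * s * q * ((1 - r) * (1 - s) * p)) := by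
    rw [mphi_pendant_pac r s p q u hsum]
    exact add_nonneg (add_nonneg (mul_nonneg (mul_nonneg hr0 (mul_nonneg h1r h1s)) hq) (mul_nonneg (mul_nonneg hr0 h1r) hu))
      (mul_nonneg (mul_nonneg (mul_nonneg (sq_nonneg (1 - r)) hs0) hp) hu)
  have h1 : 0 ≤ ((1 - r) * (1 - s) * p + ((1 - r) * (1 - s) * q + (1 - r) * u)) * (1 - r) ^ 2 * s * u * (LV - p * (LV + LQ + LU)) :=
    mul_nonneg (mul_nonneg (mul_nonneg (mul_nonneg hPI (sq_nonneg (1 - r))) hs0) hu) hV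
  have hnegU : 0 ≤ -(LU - u * (LV + LQ + LU)) := by linarith
  have h2 : 0 ≤ -((((1 - (1 - r) * (1 - s)) * p + r * (q + u)) * ((1 - r) * (1 - s) * q + (1 - r) * u) - (1 - r) * s * q * ((1 - r) * (1 - s) * p)) * (1 - r) * s) * (LU - u * (LV + LQ + LU)) := by
    rw [neg_mul, ← mul_neg]
    exact mul_nonneg (mul_nonneg (mul_nonneg hPAC h1r) hs0) hnegU
  rw [hM, mphi_pendant_regroup, hcent, hsum, hVQ, hUQ, mul_zero, add_zero, sub_self, mul_zero, add_zero]
  exact add_nonneg h1 h2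

/-- **THEOREM (pendant-type MARKER): (MPHI) = (T2) holds when `N(v) ⊆ {x, o}`** — the dual easy case (memo §2b).
Coins `α = p_{vx}`, `γ = p_{vo}`, `R' = (1−α)(1−γ)`; `H' = G − v`; `v` cannot reach `Y` except through `x, o`, so `ν'` integrates to
`λ = μ_{H'}(· | S ↮ Y)` followed by the two coins.  Types of `η`: `T1 = {x ~ o in H'}` (mass `t`), `T0` (mass `1 − t`); given `T1` the atom
is `O`; given `T0` it is `OV` w.p. `αγ` (path `x–v–o`), `PV` w.p. `α(1−γ)`, `E` w.p. `(1−α)γ`, `PM` w.p. `R'`.  So `a = t + (1−t)αγ`,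
`e = (1−t)(1−α)γ`, `π_V = (1−t)α(1−γ)`, `π_M = (1−t)R'`, and for a down-set `𝒟` with type masses `L1, L0`:
`ν'(O;𝒟) = L1 + αγ L0`, `ν'(PV;𝒟) = α(1−γ) L0`, `ν'(PM;𝒟) = R' L0`.  IDENTITY (pure ring):
`π_M·MPHI(𝒟) = [π_M π (1 − αγ) + π_M o2 α(1−γ) + (1−t) t R'²] · (L1 − t (L1 + L0))`, the bracket being `B_1 − B_0 ≥ 0` and
`L1 − t(L1+L0) = Cov_λ(1{x ~ o}, 1_𝒟(C_Y)) ≥ 0` by van den Berg–Häggström–Kahn's Thm 2.1 (`{x~o}` increasing in `C_S`, `1_𝒟`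
decreasing in `C_Y`).  Also PAC is explicit: `a π_M − e π_V = (1−t) R' t`.
[cite: KozmaNitzan2024, Question 8 (§5.5 p. 36)] [cite: VandenbergHaggstromKahn2005, Thm. 2.1 (p. 9)] -/
theorem mphi_vpendant_eq (α γ t L1 L0 : ℝ) :
    ((1 - t) * ((1 - α) * (1 - γ))) *
          (((1 - t) * (α * (1 - γ)) + (1 - t) * ((1 - α) * (1 - γ))) * (L1 + α * γ * L0) -
            (t + (1 - t) * (α * γ) + (1 - t) * ((1 - α) * γ)) * (α * (1 - γ) * L0)) -
        ((t + (1 - t) * (α * γ)) * ((1 - t) * ((1 - α) * (1 - γ))) -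
            (1 - t) * ((1 - α) * γ) * ((1 - t) * (α * (1 - γ)))) * ((1 - α) * (1 - γ) * L0) =
      ((1 - t) * ((1 - α) * (1 - γ)) * ((1 - t) * (α * (1 - γ)) + (1 - t) * ((1 - α) * (1 - γ))) * (1 - α * γ) +
          (1 - t) * ((1 - α) * (1 - γ)) * (t + (1 - t) * (α * γ) + (1 - t) * ((1 - α) * γ)) * (α * (1 - γ)) +
            (1 - t) * t * ((1 - α) * (1 - γ)) ^ 2) * (L1 - t * (L1 + L0)) ∧
      (t + (1 - t) * (α * γ)) * ((1 - t) * ((1 - α) * (1 - γ))) - (1 - t) * ((1 - α) * γ) * ((1 - t) * (α * (1 - γ))) =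
        (1 - t) * ((1 - α) * (1 - γ)) * t := by
  constructor <;> ring

/-- **(MPHI) for a pendant-type marker**, nonnegativity: for `α, γ, t ∈ [0,1]` and the BHK sign `L1 − t(L1+L0) ≥ 0`, the
denominator-free (MPHI) functional of `mphi_vpendant_eq` is `≥ 0`.
[cite: KozmaNitzan2024, Question 8 (§5.5 p. 36)] [cite: VandenbergHaggstromKahn2005, Thm. 2.1 (p. 9)] -/
theorem mphi_vpendant_nonneg (α γ t L1 L0 : ℝ) (ha0 : 0 ≤ α) (ha1 : α ≤ 1) (hg0 : 0 ≤ γ) (hg1 : γ ≤ 1)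
    (ht0 : 0 ≤ t) (ht1 : t ≤ 1) (hT : 0 ≤ L1 - t * (L1 + L0)) :
    0 ≤ ((1 - t) * ((1 - α) * (1 - γ))) *
          (((1 - t) * (α * (1 - γ)) + (1 - t) * ((1 - α) * (1 - γ))) * (L1 + α * γ * L0) -
            (t + (1 - t) * (α * γ) + (1 - t) * ((1 - α) * γ)) * (α * (1 - γ) * L0)) -
        ((t + (1 - t) * (α * γ)) * ((1 - t) * ((1 - α) * (1 - γ))) -
            (1 - t) * ((1 - α) * γ) * ((1 - t) * (α * (1 - γ)))) * ((1 - α) * (1 - γ) * L0) := by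
  rw [(mphi_vpendant_eq α γ t L1 L0).1]
  have h1a : 0 ≤ 1 - α := by linarith
  have h1g : 0 ≤ 1 - γ := by linarith
  have h1t : 0 ≤ 1 - t := by linarith
  have hag : 0 ≤ 1 - α * γ := by nlinarith
  have hR : 0 ≤ (1 - α) * (1 - γ) := mul_nonneg h1a h1g
  have hpm : 0 ≤ (1 - t) * ((1 - α) * (1 - γ)) := mul_nonneg h1t hR
  have hπ : 0 ≤ (1 - t) * (α * (1 - γ)) + (1 - t) * ((1 - α) * (1 - γ)) :=
    add_nonneg (mul_nonneg h1t (mul_nonneg ha0 h1g)) hpm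
  have ho2 : 0 ≤ t + (1 - t) * (α * γ) + (1 - t) * ((1 - α) * γ) :=
    add_nonneg (add_nonneg ht0 (mul_nonneg h1t (mul_nonneg ha0 hg0))) (mul_nonneg h1t (mul_nonneg h1a hg0))
  have hB : 0 ≤ (1 - t) * ((1 - α) * (1 - γ)) * ((1 - t) * (α * (1 - γ)) + (1 - t) * ((1 - α) * (1 - γ))) * (1 - α * γ) +
      (1 - t) * ((1 - α) * (1 - γ)) * (t + (1 - t) * (α * γ) + (1 - t) * ((1 - α) * γ)) * (α * (1 - γ)) +
        (1 - t) * t * ((1 - α) * (1 - γ)) ^ 2 :=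
    add_nonneg (add_nonneg (mul_nonneg (mul_nonneg hpm hπ) hag) (mul_nonneg (mul_nonneg hpm ho2) (mul_nonneg ha0 h1g)))
      (mul_nonneg (mul_nonneg h1t ht0) (sq_nonneg _))
  exact mul_nonneg hB hT

/-- **The x–o edge is irrelevant for (MPHI)** (memo §6a).  Along the edge `f = xo` of weight `t` the frame event and the frame cluster do not see `f`
(V(C_x ∪ C_o) is unchanged), and with `f` open the atom is `O`; so with the masses of `G ∖ f` (superscript dropped: `O, E, PV, PM` and their `𝒟`-restrictions
`OD, ED, PVD, PMD`) the masses at weight `t` are `O + t(E+PV+PM)`, `(1−t)E`, `(1−t)PV`, `(1−t)PM`, `OD + t(ED+PVD+PMD)`, `(1−t)PVD`, `(1−t)PMD`, and the (MPHI) cubic is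
  `T_G(t) = (1−t)³·T_{G∖f} + t(1−t)²·PM·[(PV+PM)·F𝒟 − F·(PVD+PMD)]`,  `F = O+E+PV+PM`, `F𝒟 = OD+ED+PVD+PMD`
(pure ring identity), where the bracket is `F²·(ν′(P)ν′(𝒟) − ν′(P ∩ 𝒟)) ≥ 0` by van den Berg–Häggström–Kahn's Thm 2.1 (`P = {o ≁ x, o ≁ v}` is decreasing in `C_S`,
`1_𝒟` decreasing in `C_Y`).  Hence (MPHI) for `G` follows from (MPHI) for `G ∖ xo`: w.l.o.g. `x` and `o` are not adjacent.
[cite: KozmaNitzan2024, Question 8 (§5.5 p. 36)] [cite: VandenbergHaggstromKahn2005, Thm. 2.1 (p. 9)] -/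
theorem mphi_xo_edge_eq (t O E PV PM OD ED PVD PMD : ℝ) :
    (1 - t) * PM * (((1 - t) * PV + (1 - t) * PM) * (OD + t * (ED + PVD + PMD)) -
          (O + t * (E + PV + PM) + (1 - t) * E) * ((1 - t) * PVD)) -
        ((O + t * (E + PV + PM)) * ((1 - t) * PM) - (1 - t) * E * ((1 - t) * PV)) * ((1 - t) * PMD) =
      (1 - t) ^ 3 * (PM * ((PV + PM) * OD - (O + E) * PVD) - (O * PM - E * PV) * PMD) +
        t * (1 - t) ^ 2 * PM * ((PV + PM) * (OD + ED + PVD + PMD) - (O + E + PV + PM) * (PVD + PMD)) := by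
  ring

/-- **(MPHI) for `G` from (MPHI) for `G ∖ xo`**: for `t ∈ [0,1]`, `PM ≥ 0`, the deleted-edge cubic `≥ 0` and the BHK sign
`(PV+PM)·F𝒟 − F·(PVD+PMD) ≥ 0`, the cubic at weight `t` is `≥ 0`.
[cite: KozmaNitzan2024, Question 8 (§5.5 p. 36)] [cite: VandenbergHaggstromKahn2005, Thm. 2.1 (p. 9)] -/
theorem mphi_xo_edge_nonneg (t O E PV PM OD ED PVD PMD : ℝ) (ht0 : 0 ≤ t) (ht1 : t ≤ 1) (hPM : 0 ≤ PM)
    (hdel : 0 ≤ PM * ((PV + PM) * OD - (O + E) * PVD) - (O * PM - E * PV) * PMD)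
    (hbhk : 0 ≤ (PV + PM) * (OD + ED + PVD + PMD) - (O + E + PV + PM) * (PVD + PMD)) :
    0 ≤ (1 - t) * PM * (((1 - t) * PV + (1 - t) * PM) * (OD + t * (ED + PVD + PMD)) -
          (O + t * (E + PV + PM) + (1 - t) * E) * ((1 - t) * PVD)) -
        ((O + t * (E + PV + PM)) * ((1 - t) * PM) - (1 - t) * E * ((1 - t) * PV)) * ((1 - t) * PMD) := by
  rw [mphi_xo_edge_eq]
  have h1t : 0 ≤ 1 - t := by linarith
  exact add_nonneg (mul_nonneg (pow_nonneg h1t 3) hdel)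
    (mul_nonneg (mul_nonneg (mul_nonneg ht0 (pow_nonneg h1t 2)) hPM) hbhk)

/-- **Commutator form of the (MPHI) cubic** (pure ring identity; memo §1): with unnormalised atom masses `O, E, PV, PM` and their `𝒟`-restrictions,
`PM·((PV+PM)·OD − (O+E)·PVD) − (O·PM − E·PV)·PMD = PM·((PV+PM)·OD − (PVD+PMD)·O) − E·(PM·PVD − PMD·PV)`,
i.e. `T_𝒟 = M_PM·[P,O]_𝒟 − M_E·[PM,PV]_𝒟` with the exchange commutator `[X,Y]_𝒟 := M_X·M_{Y𝒟} − M_{X𝒟}·M_Y` ("`Y` has the smaller frame cluster more often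
than `X`"); equivalently (MPHI) ⟺ `a·π·(ν′(𝒟|O) − ν′(𝒟|P)) ≥ e·π_V·(ν′(𝒟|PV) − ν′(𝒟|PM))`, the left side `≥ 0` by van den Berg–Häggström–Kahn's Thm 2.1.
This is the form in which the cubic is conjectured to be coefficientwise (tensor-Bernstein) nonnegative (memo §6d).
[cite: KozmaNitzan2024, Question 8 (§5.5 p. 36)] [cite: VandenbergHaggstromKahn2005, Thm. 2.1 (p. 9)] -/
theorem mphi_commutator_form (O E PV PM OD PVD PMD : ℝ) :
    PM * ((PV + PM) * OD - (O + E) * PVD) - (O * PM - E * PV) * PMD =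
      PM * ((PV + PM) * OD - (PVD + PMD) * O) - E * (PM * PVD - PMD * PV) := by
  ring

/-- **One-edge Bernstein decomposition of the (MPHI) cubic** (pure ring identity; memo §6).  Along any edge `f` of weight `t` every atom mass is affine,
`X(t) = X₀ + t (X₁ − X₀)` with `X₀` the mass of `G ∖ f` and `X₁` the mass with `f` open (`= G/f`).  Writing `T(X) = PM·[P,O]_𝒟 − E·[PM,PV]_𝒟`
(`mphi_commutator_form`) and `[Xᵢ,Yⱼ] := Xᵢ·Y𝒟ⱼ − X𝒟ᵢ·Yⱼ` for the mixed commutators, the cubic is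
`T(X(t)) = (1−t)³·T(X₀) + 3t(1−t)²·b₁ + 3t²(1−t)·b₂ + t³·T(X₁)` with the polarised coefficients
`3 b₁ = PM₁[P₀,O₀] + PM₀([P₁,O₀] + [P₀,O₁]) − E₁[PM₀,PV₀] − E₀([PM₁,PV₀] + [PM₀,PV₁])` and `b₂` = the same with 0 ↔ 1.
(MPHI) for all graphs follows from `b₁, b₂ ≥ 0` along the edges at `x` (base case: `x` isolated ⇒ `T ≡ 0`); census: `b₁, b₂ ≥ 0` along EVERY edge class
(kit j107978, 1.67·10⁶ instances / 1.75·10⁷ tests for the connection target; memo §6).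
[cite: KozmaNitzan2024, Question 8 (§5.5 p. 36)] -/
theorem mphi_oneedge_bernstein (t O₀ E₀ PV₀ PM₀ OD₀ PVD₀ PMD₀ O₁ E₁ PV₁ PM₁ OD₁ PVD₁ PMD₁ : ℝ) :
    let Tc := fun (O E PV PM OD PVD PMD : ℝ) => PM * ((PV + PM) * OD - (PVD + PMD) * O) - E * (PM * PVD - PMD * PV)
    let b₁ := (PM₁ * ((PV₀ + PM₀) * OD₀ - (PVD₀ + PMD₀) * O₀) +
        PM₀ * (((PV₁ + PM₁) * OD₀ - (PVD₁ + PMD₁) * O₀) + ((PV₀ + PM₀) * OD₁ - (PVD₀ + PMD₀) * O₁)) -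
        E₁ * (PM₀ * PVD₀ - PMD₀ * PV₀) - E₀ * ((PM₁ * PVD₀ - PMD₁ * PV₀) + (PM₀ * PVD₁ - PMD₀ * PV₁))) / 3
    let b₂ := (PM₀ * ((PV₁ + PM₁) * OD₁ - (PVD₁ + PMD₁) * O₁) +
        PM₁ * (((PV₀ + PM₀) * OD₁ - (PVD₀ + PMD₀) * O₁) + ((PV₁ + PM₁) * OD₀ - (PVD₁ + PMD₁) * O₀)) -
        E₀ * (PM₁ * PVD₁ - PMD₁ * PV₁) - E₁ * ((PM₀ * PVD₁ - PMD₀ * PV₁) + (PM₁ * PVD₀ - PMD₁ * PV₀))) / 3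
    Tc (O₀ + t * (O₁ - O₀)) (E₀ + t * (E₁ - E₀)) (PV₀ + t * (PV₁ - PV₀)) (PM₀ + t * (PM₁ - PM₀))
        (OD₀ + t * (OD₁ - OD₀)) (PVD₀ + t * (PVD₁ - PVD₀)) (PMD₀ + t * (PMD₁ - PMD₀)) =
      (1 - t) ^ 3 * Tc O₀ E₀ PV₀ PM₀ OD₀ PVD₀ PMD₀ + 3 * t * (1 - t) ^ 2 * b₁ + 3 * t ^ 2 * (1 - t) * b₂ +
        t ^ 3 * Tc O₁ E₁ PV₁ PM₁ OD₁ PVD₁ PMD₁ := by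
  intro Tc b₁ b₂
  simp only [Tc, b₁, b₂]
  ring

/-- **The O-part of the one-edge step is nonnegative** (memo §6e; the step along an edge `f = (o,z)` or `(x,z)`).  In `3b₁ = PM₁[P₀,O₀] + PM₀([P₁,O₀]+[P₀,O₁]) − (E-part)`
(`mphi_oneedge_bernstein`) the O-part is `≥ 0` given six van den Berg–Häggström–Kahn inequalities between the frame-restricted masses of `G∖f` (subscript 0) and `G/f`
(subscript 1; `F` = total frame mass, `FD` its `𝒟`-part): `h1`/`h3`: `ν(𝒟|O) ≥ ν(𝒟)` in each graph (Thm 2.1, `O` increasing in `C_S`); `h2`/`h4`: `ν(𝒟|P) ≤ ν(𝒟)`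
(`P` decreasing); `h5`: `ν₁(𝒟) ≥ ν₀(𝒟)` (the frame of `G/f` adds `z ∉ C_Y`, and `1{z ∉ C_Y}`, `1_𝒟` are both decreasing in `C_Y`, which is positively associated given
`S ↮ Y`, Thm 1.3); `h6`: `O₁P₀ ≥ O₀P₁` (since `O₁/O₀ ≥ μ(z↮Y | O) ≥ μ(z↮Y | P) ≥ P₁/P₀` by two more applications of Thm 2.1).  Proof: `F₀·[P₀,O₀]` and
`F₀F₁·([P₁,O₀]+[P₀,O₁]) − (F₀FD₁ − F₁FD₀)(P₀O₁ − P₁O₀)` are explicit nonnegative combinations of `h1…h4`.  So the one-edge induction step for (MPHI) along o- or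
x-edges is exactly 'proved O-gap ≥ E-weighted [PM,PV]-gaps' one level up (census: `b₁ ≥ 0` in every instance).
[cite: KozmaNitzan2024, Question 8 (§5.5 p. 36)] [cite: VandenbergHaggstromKahn2005, Thm. 2.1 (p. 9), Thm. 1.3 (p. 6)] -/
theorem mphi_oneedge_Opart_nonneg (F0 FD0 F1 FD1 O0 OD0 O1 P0 PD0 P1 PD1 OD1 PM0 PM1 : ℝ)
    (hF0 : 0 < F0) (hF1 : 0 < F1) (hO0 : 0 ≤ O0) (hO1 : 0 ≤ O1) (hP0 : 0 ≤ P0) (hP1 : 0 ≤ P1) (hPM0 : 0 ≤ PM0) (hPM1 : 0 ≤ PM1)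
    (h1 : O0 * FD0 ≤ OD0 * F0) (h2 : PD0 * F0 ≤ P0 * FD0) (h3 : O1 * FD1 ≤ OD1 * F1) (h4 : PD1 * F1 ≤ P1 * FD1)
    (h5 : FD0 * F1 ≤ FD1 * F0) (h6 : O0 * P1 ≤ O1 * P0) :
    0 ≤ PM1 * (P0 * OD0 - PD0 * O0) + PM0 * ((P1 * OD0 - PD1 * O0) + (P0 * OD1 - PD0 * O1)) := by
  -- [P0,O0] ≥ 0
  have e1 : F0 * (P0 * OD0 - PD0 * O0) = P0 * (OD0 * F0 - O0 * FD0) + O0 * (P0 * FD0 - PD0 * F0) := by ring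
  have n1 : 0 ≤ F0 * (P0 * OD0 - PD0 * O0) := by
    rw [e1]; exact add_nonneg (mul_nonneg hP0 (by linarith)) (mul_nonneg hO0 (by linarith))
  have c1 : 0 ≤ P0 * OD0 - PD0 * O0 := le_of_mul_le_mul_left (by simpa using n1) hF0
  -- cross sum ≥ 0
  have e2 : F0 * F1 * ((P1 * OD0 - PD1 * O0) + (P0 * OD1 - PD0 * O1)) =
      P1 * F1 * (OD0 * F0 - O0 * FD0) + O0 * F0 * (P1 * FD1 - PD1 * F1) + P0 * F0 * (OD1 * F1 - O1 * FD1) +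
        O1 * F1 * (P0 * FD0 - PD0 * F0) + (F0 * FD1 - F1 * FD0) * (P0 * O1 - P1 * O0) := by ring
  have n2 : 0 ≤ F0 * F1 * ((P1 * OD0 - PD1 * O0) + (P0 * OD1 - PD0 * O1)) := by
    rw [e2]
    have hF0' : 0 ≤ F0 := hF0.le
    have hF1' : 0 ≤ F1 := hF1.le
    have t1 : 0 ≤ P1 * F1 * (OD0 * F0 - O0 * FD0) := mul_nonneg (mul_nonneg hP1 hF1') (by linarith)
    have t2 : 0 ≤ O0 * F0 * (P1 * FD1 - PD1 * F1) := mul_nonneg (mul_nonneg hO0 hF0') (by linarith)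
    have t3 : 0 ≤ P0 * F0 * (OD1 * F1 - O1 * FD1) := mul_nonneg (mul_nonneg hP0 hF0') (by linarith)
    have t4 : 0 ≤ O1 * F1 * (P0 * FD0 - PD0 * F0) := mul_nonneg (mul_nonneg hO1 hF1') (by linarith)
    have t5 : 0 ≤ (F0 * FD1 - F1 * FD0) * (P0 * O1 - P1 * O0) := mul_nonneg (by linarith) (by linarith)
    linarith
  have c2 : 0 ≤ (P1 * OD0 - PD1 * O0) + (P0 * OD1 - PD0 * O1) :=
    le_of_mul_le_mul_left (by simpa using n2) (mul_pos hF0 hF1)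
  exact add_nonneg (mul_nonneg hPM1 c1) (mul_nonneg hPM0 c2)

/-- **Step anatomy** (pure ring identity; memo §6e): with `T₀ := PM₀[P₀,O₀] − E₀[PM₀,PV₀]` the (MPHI) cubic of `G ∖ f`, the polarised coefficient satisfies
`PM₀·(3b₁) = PM₁·T₀ + R̂₂`,  `R̂₂ := PM₀²·cross − PM₀E₀·ecross − (E₁PM₀ − PM₁E₀)·[PM₀,PV₀]`,  `cross = [P₁,O₀]+[P₀,O₁]`, `ecross = [PM₁,PV₀]+[PM₀,PV₁]`:
given (MPHI) for `G ∖ f` the induction step along `f` is the single two-graph inequality `R̂₂ ≥ 0` (census-clean; its O-part `cross ≥ 0` is `mphi_oneedge_Opart_nonneg`).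
[cite: KozmaNitzan2024, Question 8 (§5.5 p. 36)] -/
theorem mphi_oneedge_step_anatomy (O₀ E₀ PV₀ PM₀ OD₀ PVD₀ PMD₀ O₁ E₁ PV₁ PM₁ OD₁ PVD₁ PMD₁ : ℝ) :
    PM₀ * (PM₁ * ((PV₀ + PM₀) * OD₀ - (PVD₀ + PMD₀) * O₀) +
        PM₀ * (((PV₁ + PM₁) * OD₀ - (PVD₁ + PMD₁) * O₀) + ((PV₀ + PM₀) * OD₁ - (PVD₀ + PMD₀) * O₁)) -
        E₁ * (PM₀ * PVD₀ - PMD₀ * PV₀) - E₀ * ((PM₁ * PVD₀ - PMD₁ * PV₀) + (PM₀ * PVD₁ - PMD₀ * PV₁))) =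
      PM₁ * (PM₀ * ((PV₀ + PM₀) * OD₀ - (PVD₀ + PMD₀) * O₀) - E₀ * (PM₀ * PVD₀ - PMD₀ * PV₀)) +
        (PM₀ ^ 2 * (((PV₁ + PM₁) * OD₀ - (PVD₁ + PMD₁) * O₀) + ((PV₀ + PM₀) * OD₁ - (PVD₀ + PMD₀) * O₁)) -
          PM₀ * E₀ * ((PM₁ * PVD₀ - PMD₁ * PV₀) + (PM₀ * PVD₁ - PMD₀ * PV₁)) -
          (E₁ * PM₀ - PM₁ * E₀) * (PM₀ * PVD₀ - PMD₀ * PV₀)) := by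
  ring

end PocketCert

end Summit.CriticalPhenomena.PercolationContinuityZ3.Theorems
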